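import Mathlib.Analysis.Analytic.Binomial
import Literature.Probability.LatticeModels.SphereReflectionPositivity

/-!
# Neeb–Ólafsson 2014, Prop. 6.2 — proofs I: the necessity half (`0 < s < n - 2` fails)

K.-H. Neeb, G. Ólafsson, *Reflection positivity and conformal symmetry*, J. Funct. Anal. 266
(2014) 2174–2224 = arXiv:1206.2039, §6.2 Proposition 6.2 (arXiv numbering: Prop. 8, p. 23):
the ball kernel `R_s(x, y) = (1 − 2⟨x, y⟩ + ‖x‖²‖y‖²)^{−s/2}` on the open unit ball of `ℝⁿ` is
positive definite iff `s = 0` or `s ≥ max(0, n − 2)`; vendored as the named fact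
`neebOlafsson2014_ballKernel_posSemidef_iff` (file `SphereReflectionPositivity`). The printed
proof transports the question by a conformal involution to the half-space picture and invokes
the Wallach set of the light cone ([FK94] = Faraut–Korányi) — harmonic analysis that Mathlib
does not have. This file gives an independent, elementary proof of the **"only if" half in
every dimension**:

* `ballKernel_not_posSemidef`: for `0 < s < n − 2` (so `n ≥ 3`) the `(2n+1)`-point configuration
  `{0} ∪ {±ε eᵢ}` with coefficients `(−2n, 1, …, 1)` has quadratic form
  `2n · f(ε²)`, `f(u) = (1−u)^{−s} + (1+u)^{−s} + 2(n−1)(1+u²)^{−s/2} − 2n = s(s+2−n)u² + O(u³)`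
  (`exists_neg_of_lt_sub_two`, from Mathlib's binomial series
  `Real.one_add_rpow_hasFPowerSeriesOnBall_zero`), which is negative for small `u` exactly when
  `s < n − 2` — the second-order obstruction is the isotropic second moment
  `λ[2(λ+1)‖M‖² − (tr M)²]`, `λ = s/2`, `M = Σ c_a x_a x_aᵀ = 2ε² I_n`;
* `neebOlafsson2014_ballKernel_posSemidef_only_if`: the `(⇒)` half of the fact, all `n`.

The sufficiency half (`s = 0`; `n = 1, 2` all `s ≥ 0`; `n ≥ 3`, `s ≥ n − 2`) is the business of
`SphereReflectionPositivityProofs`. Also here: the real-quadratic-form interface to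
`Matrix.PosSemidef` used by both files.

## References

* K.-H. Neeb, G. Ólafsson, J. Funct. Anal. 266 (2014) 2174–2224, arXiv:1206.2039, §6.2
  Prop. 6.2. [`NeebOlafsson2014`]
-/

noncomputable section

open scoped RealInnerProductSpace
open Finset Filter Asymptotics Topology

namespace Literature.Probability.LatticeModels

/-! ### Real quadratic forms and `Matrix.PosSemidef` -/

section Toolkit

variable {ι : Type*} [Fintype ι]

/-- A real symmetric matrix is positive semidefinite iff its real quadratic form
`Σ_{a,b} c_a c_b M_{ab}` is nonnegative. [folklore] -/
theorem posSemidef_iff_sum_mul_nonneg {M : Matrix ι ι ℝ} (hM : ∀ a b, M a b = M b a) :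
    M.PosSemidef ↔ ∀ c : ι → ℝ, 0 ≤ ∑ a, ∑ b, c a * c b * M a b := by
  have hH : M.IsHermitian := Matrix.IsHermitian.ext fun a b => by simpa using hM b a
  rw [Matrix.posSemidef_iff_dotProduct_mulVec]
  simp only [hH, true_and, star_trivial, dotProduct, Matrix.mulVec, Finset.mul_sum]
  refine forall_congr' fun c => ?_
  rw [show (∑ a, ∑ b, c a * c b * M a b) = ∑ a, ∑ b, c a * (M a b * c b) from
    Finset.sum_congr rfl fun a _ => Finset.sum_congr rfl fun b _ => by ring]

/-- The real quadratic form of a positive semidefinite real matrix is nonnegative. [folklore] -/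
theorem sum_mul_nonneg_of_posSemidef {M : Matrix ι ι ℝ} (hM : M.PosSemidef) (c : ι → ℝ) :
    0 ≤ ∑ a, ∑ b, c a * c b * M a b := by
  have hsymm : ∀ a b, M a b = M b a := fun a b => by
    simpa using (hM.isHermitian.apply a b).symm
  exact (posSemidef_iff_sum_mul_nonneg hsymm).1 hM c

/-- A rank-one Gram matrix `d · f fᵀ` with `d ≥ 0` is positive semidefinite. [folklore] -/
theorem posSemidef_of_smul_gram {d : ℝ} (hd : 0 ≤ d) (f : ι → ℝ) :
    (Matrix.of fun a b : ι => d * (f a * f b)).PosSemidef := by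
  refine (posSemidef_iff_sum_mul_nonneg fun a b => by simp [mul_comm]).2 fun c => ?_
  have : ∑ a, ∑ b, c a * c b * (Matrix.of fun a b : ι => d * (f a * f b)) a b =
      d * ((∑ a, c a * f a) * (∑ b, c b * f b)) := by
    rw [Finset.sum_mul_sum, Finset.mul_sum]
    refine Finset.sum_congr rfl fun a _ => ?_
    rw [Finset.mul_sum]
    exact Finset.sum_congr rfl fun b _ => by simp only [Matrix.of_apply]; ring
  rw [this]
  exact mul_nonneg hd (mul_self_nonneg _)

/-- An entrywise `HasSum`-limit of positive semidefinite real matrices is positive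
semidefinite. [folklore] -/
theorem posSemidef_of_hasSum {κ : Type*} {M : Matrix ι ι ℝ} {N : κ → Matrix ι ι ℝ}
    (hN : ∀ k, (N k).PosSemidef) (h : ∀ a b, HasSum (fun k => N k a b) (M a b)) :
    M.PosSemidef := by
  have hNs : ∀ k a b, N k a b = N k b a := fun k a b => by
    simpa using ((hN k).isHermitian.apply a b).symm
  have hsymm : ∀ a b, M a b = M b a := fun a b =>
    (h a b).unique (by simpa only [hNs] using h b a)
  refine (posSemidef_iff_sum_mul_nonneg hsymm).2 fun c => ?_
  have hS : HasSum (fun k => ∑ a, ∑ b, c a * c b * N k a b) (∑ a, ∑ b, c a * c b * M a b) :=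
    hasSum_sum fun a _ => hasSum_sum fun b _ => (h a b).mul_left _
  exact hS.nonneg fun k => sum_mul_nonneg_of_posSemidef (hN k) c

end Toolkit

/-- rpow algebra: `(y²)^{-s/2} = y^{-s}` for `y ≥ 0` (no junk: both sides are the principal
real powers of a nonnegative base). [folklore] -/
theorem sq_rpow_neg_half {y s : ℝ} (hy : 0 ≤ y) : (y ^ 2) ^ (-s / 2) = y ^ (-s) := by
  rw [show (y ^ 2 : ℝ) = y ^ ((2 : ℕ) : ℝ) from (Real.rpow_natCast y 2).symm,
    ← Real.rpow_mul hy]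
  norm_num
  ring_nf

/-! ### Second-order Taylor expansions of `(1 + y)^a` from the binomial series -/

/-- `Ring.choose a 2 = a(a-1)/2` over `ℝ`. [folklore] -/
theorem ring_choose_two (a : ℝ) : Ring.choose a 2 = a * (a - 1) / 2 := by
  rw [Ring.choose_eq_smul, Polynomial.descPochhammer_smeval_eq_ascPochhammer,
    Polynomial.ascPochhammer_smeval_eq_eval, ascPochhammer_succ_right, ascPochhammer_one]
  simp
  ring

/-- Second-order Taylor expansion of `(1 + y)^a` at `0` with `O(|y|³)` remainder, read off
from the binomial series (Mathlib: `Real.one_add_rpow_hasFPowerSeriesOnBall_zero`). [folklore] -/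
theorem isBigO_one_add_rpow_sub_taylor_two (a : ℝ) :
    (fun y : ℝ => (1 + y) ^ a - (1 + a * y + a * (a - 1) / 2 * y ^ 2)) =O[𝓝 0]
      fun y => |y| ^ 3 := by
  have h := (Real.one_add_rpow_hasFPowerSeriesOnBall_zero (a := a)).hasFPowerSeriesAt
    |>.isBigO_sub_partialSum_pow 3
  simp only [zero_add, Real.norm_eq_abs] at h
  refine h.congr_left fun y => ?_
  simp only [FormalMultilinearSeries.partialSum, binomialSeries,
    FormalMultilinearSeries.ofScalars_apply_eq, Finset.sum_range_succ, Finset.sum_range_zero,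
    smul_eq_mul, Ring.choose_zero_right, Ring.choose_one_right, ring_choose_two]
  ring

/-- First-order Taylor expansion of `(1 + y)^a` at `0` with `O(|y|²)` remainder. [folklore] -/
theorem isBigO_one_add_rpow_sub_taylor_one (a : ℝ) :
    (fun y : ℝ => (1 + y) ^ a - (1 + a * y)) =O[𝓝 0] fun y => |y| ^ 2 := by
  have h := (Real.one_add_rpow_hasFPowerSeriesOnBall_zero (a := a)).hasFPowerSeriesAt
    |>.isBigO_sub_partialSum_pow 2
  simp only [zero_add, Real.norm_eq_abs] at h
  refine h.congr_left fun y => ?_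
  simp only [FormalMultilinearSeries.partialSum, binomialSeries,
    FormalMultilinearSeries.ofScalars_apply_eq, Finset.sum_range_succ, Finset.sum_range_zero,
    smul_eq_mul, Ring.choose_zero_right, Ring.choose_one_right]
  ring

/-- **The scalar inequality behind the necessity half of Prop. 6.2.** For `0 < s < N - 2` the
function `f(u) = (1-u)^{-s} + (1+u)^{-s} + 2(N-1)(1+u²)^{-s/2} - 2N` satisfies
`f(u) = s(s+2-N)u² + O(|u|³)` at `0`, hence `f(u) < 0` for some `u ∈ (0, 1)`.
[cite: NeebOlafsson2014, Prop. 6.2 ("only if"; this elementary witness computation is ours)] -/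
theorem exists_neg_of_lt_sub_two {N s : ℝ} (hs : 0 < s) (hsN : s < N - 2) :
    ∃ u : ℝ, 0 < u ∧ u < 1 ∧
      (1 - u) ^ (-s) + (1 + u) ^ (-s) + 2 * (N - 1) * (1 + u ^ 2) ^ (-s / 2) - 2 * N < 0 := by
  set κ : ℝ := s * (s + 2 - N) with hκ
  have hκneg : κ < 0 := mul_neg_of_pos_of_neg hs (by linarith)
  set F : ℝ → ℝ := fun u =>
    (1 - u) ^ (-s) + (1 + u) ^ (-s) + 2 * (N - 1) * (1 + u ^ 2) ^ (-s / 2) - 2 * N with hF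
  -- Taylor remainders of the three terms
  have h1 := isBigO_one_add_rpow_sub_taylor_two (-s)
  have h2 : (fun u : ℝ => (1 + -u) ^ (-s) - (1 + -s * -u + -s * (-s - 1) / 2 * (-u) ^ 2))
      =O[𝓝 0] fun u => |(-u)| ^ 3 :=
    h1.comp_tendsto (by simpa using (continuous_neg (G := ℝ)).tendsto 0)
  have h3 : (fun u : ℝ => (1 + u ^ 2) ^ (-s / 2) - (1 + -s / 2 * u ^ 2))
      =O[𝓝 0] fun u => |u ^ 2| ^ 2 :=
    (isBigO_one_add_rpow_sub_taylor_one (-s / 2)).comp_tendsto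
      (by simpa using (continuous_pow 2 (M := ℝ)).tendsto 0)
  have h3' : (fun u : ℝ => |u ^ 2| ^ 2) =O[𝓝 0] fun u => |u| ^ 3 := by
    refine IsBigO.of_bound 1 ?_
    filter_upwards [eventually_abs_sub_lt 0 (zero_lt_one' ℝ)] with u hu
    rw [sub_zero] at hu
    simp only [Real.norm_eq_abs, abs_pow, abs_abs, one_mul, ← pow_mul]
    exact pow_le_pow_of_le_one (abs_nonneg u) hu.le (by norm_num)
  have hrem : (fun u => F u - κ * u ^ 2) =O[𝓝 0] fun u => |u| ^ 3 := by
    have h2abs : (fun u : ℝ => |(-u)| ^ 3) = fun u => |u| ^ 3 := by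
      funext u; rw [abs_neg]
    rw [h2abs] at h2
    have h123 := (h2.add h1).add ((h3.trans h3').const_mul_left (2 * (N - 1)))
    refine (h123.congr_left fun u => ?_)
    simp only [hF, hκ, sub_eq_add_neg, neg_mul, mul_neg, neg_neg]
    ring
  -- quantitative bound near `0⁺` and a point where `F < 0`
  obtain ⟨C, hCpos, hC⟩ := hrem.exists_pos
  have hbound : ∀ᶠ u in 𝓝[>] (0 : ℝ), |F u - κ * u ^ 2| ≤ C * |u| ^ 3 := by
    have := hC.bound
    refine nhdsWithin_le_nhds (this.mono fun u hu => ?_)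
    simpa only [Real.norm_eq_abs, abs_pow, abs_abs] using hu
  have hsmall : ∀ᶠ u in 𝓝[>] (0 : ℝ), u < min 1 (-κ / (2 * C)) :=
    nhdsWithin_le_nhds (eventually_lt_nhds (lt_min one_pos (div_pos (by linarith) (by linarith))))
  have hposu : ∀ᶠ u in 𝓝[>] (0 : ℝ), 0 < u := eventually_mem_nhdsWithin
  obtain ⟨u, hu1, hu2, hu3⟩ := (hbound.and (hsmall.and hposu)).exists
  refine ⟨u, hu3, hu2.trans_le (min_le_left _ _), ?_⟩
  have hult : u < -κ / (2 * C) := hu2.trans_le (min_le_right _ _)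
  have habs : |u| = u := abs_of_pos hu3
  rw [habs] at hu1
  have hF' : F u ≤ κ * u ^ 2 + C * u ^ 3 := by
    have := (abs_le.1 hu1).2
    linarith
  have hCu : C * u < -κ / 2 := by
    have := (lt_div_iff₀ (by linarith : (0:ℝ) < 2 * C)).1 hult
    linarith
  have : C * u ^ 3 < -κ / 2 * u ^ 2 := by
    have hu2pos : 0 < u ^ 2 := by positivity
    nlinarith
  show F u < 0
  nlinarith [sq_nonneg u]

/-! ### The witness configuration `{0} ∪ {±ε eᵢ}` -/

section Witness

variable {n : ℕ}

/-- `R_s(0, y) = 1`. [folklore] -/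
theorem ballKernel_zero_left (s : ℝ) (y : EuclideanSpace ℝ (Fin n)) : ballKernel n s 0 y = 1 := by
  simp [ballKernel]

/-- `R_s(x, 0) = 1`. [folklore] -/
theorem ballKernel_zero_right (s : ℝ) (x : EuclideanSpace ℝ (Fin n)) :
    ballKernel n s x 0 = 1 := by
  simp [ballKernel]

/-- The kernel on two scaled basis vectors:
`R_s(a eᵢ, b eⱼ) = (1 − 2ab[i = j] + a²b²)^{−s/2}`. [folklore] -/
theorem ballKernel_single_single (s a b : ℝ) (i j : Fin n) :
    ballKernel n s (EuclideanSpace.single i a) (EuclideanSpace.single j b) =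
      (1 - 2 * (if i = j then a * b else 0) + a ^ 2 * b ^ 2) ^ (-s / 2) := by
  simp only [ballKernel, EuclideanSpace.inner_single_left, PiLp.single_apply, PiLp.norm_single,
    Real.norm_eq_abs, sq_abs, conj_trivial]
  by_cases h : i = j
  · subst h; simp
  · simp [h]

/-- `Σ_i Σ_j (if i = j then A else C) = n A + (n² - n) C` over `Fin n`. [folklore] -/
theorem sum_sum_ite_eq_const (A C : ℝ) :
    ∑ i : Fin n, ∑ j : Fin n, (if i = j then A else C) = n * A + (n * n - n) * C := by
  have : ∀ i : Fin n, ∑ j : Fin n, (if i = j then A else C) = A + (n - 1) * C := fun i => by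
    have h : ∀ j : Fin n, (if i = j then A else C) = C + if i = j then A - C else 0 :=
      fun j => by split_ifs <;> ring
    simp_rw [h, Finset.sum_add_distrib, Finset.sum_const, Finset.card_univ, Fintype.card_fin,
      Finset.sum_ite_eq, Finset.mem_univ, if_true, nsmul_eq_mul]
    ring
  simp_rw [this, Finset.sum_const, Finset.card_univ, Fintype.card_fin, nsmul_eq_mul]
  ring

/-- **The quadratic form of the witness configuration.** Index the `2n + 1` points by
`Option (Fin n ⊕ Fin n)`: `none ↦ 0`, `inl i ↦ ε eᵢ`, `inr i ↦ −ε eᵢ`, with coefficients `−2n`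
at the origin and `1` elsewhere. Then, with `u = ε²`,
`Σ_{a,b} c_a c_b R_s(x_a, x_b) = 2n · [(1−u)^{−s} + (1+u)^{−s} + 2(n−1)(1+u²)^{−s/2} − 2n]`.
[cite: NeebOlafsson2014, Prop. 6.2 ("only if"; witness computation ours)] -/
theorem witness_quadratic_form (s : ℝ) {ε : ℝ} (hε : |ε| < 1) :
    ∑ a : Option (Fin n ⊕ Fin n), ∑ b : Option (Fin n ⊕ Fin n),
      (a.elim (-(2 * (n : ℝ))) fun _ => 1) * (b.elim (-(2 * (n : ℝ))) fun _ => 1) *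
        ballKernel n s
          (a.elim 0 (Sum.elim (fun i => EuclideanSpace.single i ε)
            fun i => EuclideanSpace.single i (-ε)))
          (b.elim 0 (Sum.elim (fun i => EuclideanSpace.single i ε)
            fun i => EuclideanSpace.single i (-ε))) =
      2 * n * ((1 - ε ^ 2) ^ (-s) + (1 + ε ^ 2) ^ (-s) +
        2 * (n - 1) * (1 + (ε ^ 2) ^ 2) ^ (-s / 2) - 2 * n) := by
  have hu : ε ^ 2 < 1 := (sq_lt_one_iff_abs_lt_one ε).2 hε
  -- the three kernel values `A = (1-u)^{-s}`, `B = (1+u)^{-s}`, `C = (1+u²)^{-s/2}`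
  have hA : ∀ i j : Fin n, ballKernel n s (EuclideanSpace.single i ε) (EuclideanSpace.single j ε)
      = if i = j then (1 - ε ^ 2) ^ (-s) else (1 + (ε ^ 2) ^ 2) ^ (-s / 2) := fun i j => by
    rw [ballKernel_single_single]
    split_ifs with h
    · rw [show 1 - 2 * (ε * ε) + ε ^ 2 * ε ^ 2 = (1 - ε ^ 2) ^ 2 by ring]
      exact sq_rpow_neg_half (by linarith)
    · ring_nf
  have hA' : ∀ i j : Fin n,
      ballKernel n s (EuclideanSpace.single i (-ε)) (EuclideanSpace.single j (-ε)) =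
      if i = j then (1 - ε ^ 2) ^ (-s) else (1 + (ε ^ 2) ^ 2) ^ (-s / 2) := fun i j => by
    rw [ballKernel_single_single]
    split_ifs with h
    · rw [show 1 - 2 * (-ε * -ε) + (-ε) ^ 2 * (-ε) ^ 2 = (1 - ε ^ 2) ^ 2 by ring]
      exact sq_rpow_neg_half (by linarith)
    · ring_nf
  have hB : ∀ i j : Fin n,
      ballKernel n s (EuclideanSpace.single i ε) (EuclideanSpace.single j (-ε)) =
      if i = j then (1 + ε ^ 2) ^ (-s) else (1 + (ε ^ 2) ^ 2) ^ (-s / 2) := fun i j => by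
    rw [ballKernel_single_single]
    split_ifs with h
    · rw [show 1 - 2 * (ε * -ε) + ε ^ 2 * (-ε) ^ 2 = (1 + ε ^ 2) ^ 2 by ring]
      exact sq_rpow_neg_half (by positivity)
    · ring_nf
  have hB' : ∀ i j : Fin n,
      ballKernel n s (EuclideanSpace.single i (-ε)) (EuclideanSpace.single j ε) =
      if i = j then (1 + ε ^ 2) ^ (-s) else (1 + (ε ^ 2) ^ 2) ^ (-s / 2) := fun i j => by
    rw [ballKernel_single_single]
    split_ifs with h
    · rw [show 1 - 2 * (-ε * ε) + (-ε) ^ 2 * ε ^ 2 = (1 + ε ^ 2) ^ 2 by ring]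
      exact sq_rpow_neg_half (by positivity)
    · ring_nf
  simp only [Fintype.sum_option, Fintype.sum_sum_type, Option.elim_none, Option.elim_some,
    Sum.elim_inl, Sum.elim_inr, ballKernel_zero_left, ballKernel_zero_right, hA, hA', hB, hB',
    sum_sum_ite_eq_const, Finset.sum_add_distrib, Finset.sum_const, Finset.card_univ,
    Fintype.card_fin, Fintype.card_sum, nsmul_eq_mul, mul_one, one_mul]
  push_cast
  ring

end Witness

/-! ### Necessity -/

/-- **Prop. 6.2, necessity (`0 < s < n - 2`, so `n ≥ 3`): the ball kernel is NOT positive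
definite.** The `(2n+1)`-point configuration `{0} ∪ {±ε eᵢ}` with coefficients `(−2n, 1, …, 1)`
has quadratic form `2n · f(ε²) < 0` for a suitable small `ε` (`exists_neg_of_lt_sub_two`,
`witness_quadratic_form`). Neeb–Ólafsson obtain this from the Wallach set of the light cone;
the elementary witness is ours. [cite: NeebOlafsson2014, Prop. 6.2 (§6.2), "only if"] -/
theorem ballKernel_not_posSemidef {n : ℕ} {s : ℝ} (hs : 0 < s) (hsn : s < (n : ℝ) - 2) :
    ∃ (m : ℕ) (x : Fin m → EuclideanSpace ℝ (Fin n)), (∀ a, ‖x a‖ < 1) ∧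
      ¬ (Matrix.of fun a b : Fin m =>
          (1 - 2 * inner ℝ (x a) (x b) + ‖x a‖ ^ 2 * ‖x b‖ ^ 2) ^ (-s / 2)).PosSemidef := by
  classical
  obtain ⟨u, hu0, hu1, hneg⟩ := exists_neg_of_lt_sub_two (N := (n : ℝ)) hs hsn
  have hεsq : Real.sqrt u ^ 2 = u := Real.sq_sqrt hu0.le
  have hεabs : |Real.sqrt u| < 1 := by
    rw [abs_of_nonneg (Real.sqrt_nonneg u)]
    simpa using Real.sqrt_lt_sqrt hu0.le hu1
  -- the witness points, indexed by `Option (Fin n ⊕ Fin n)`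
  set x : Option (Fin n ⊕ Fin n) → EuclideanSpace ℝ (Fin n) := fun o =>
    o.elim 0 (Sum.elim (fun i => EuclideanSpace.single i (Real.sqrt u))
      fun i => EuclideanSpace.single i (-Real.sqrt u)) with hx
  have hxlt : ∀ o, ‖x o‖ < 1 := fun o => by
    rcases o with _ | i | i <;> simp [hx, PiLp.norm_single, hεabs]
  set e := Fintype.equivFin (Option (Fin n ⊕ Fin n)) with he
  refine ⟨_, x ∘ e.symm, fun a => hxlt _, fun hM => ?_⟩
  have hK : (Matrix.of fun a b : Option (Fin n ⊕ Fin n) =>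
      ballKernel n s (x a) (x b)).PosSemidef := by
    convert hM.submatrix e using 1
    ext a b
    simp [ballKernel]
  have hQ := sum_mul_nonneg_of_posSemidef hK (fun o => o.elim (-(2 * (n : ℝ))) fun _ => 1)
  simp only [Matrix.of_apply, hx] at hQ
  rw [witness_quadratic_form s hεabs, hεsq] at hQ
  have hn : (0 : ℝ) < n := by linarith
  have : (0 : ℝ) < 2 * n := by linarith
  nlinarith

/-- **Neeb–Ólafsson 2014, Prop. 6.2 — the "only if" half, every dimension.** For `s ≥ 0`:
if every finite kernel matrix `(R_s(x_a, x_b))_{a,b}`, `‖x_a‖ < 1`, is positive semidefinite,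
then `s = 0` or `s ≥ n − 2`. (For `n ≤ 2` the conclusion is automatic; for `0 < s < n − 2` the
witness of `ballKernel_not_posSemidef` refutes positivity.) This is the `(⇒)` direction of the
named fact `neebOlafsson2014_ballKernel_posSemidef_iff`, PROVED.
[cite: NeebOlafsson2014, Prop. 6.2 (§6.2, arXiv:1206.2039 p. 23), "only if"] -/
theorem neebOlafsson2014_ballKernel_posSemidef_only_if (n : ℕ) (s : ℝ) (hs : 0 ≤ s)
    (H : ∀ (m : ℕ) (x : Fin m → EuclideanSpace ℝ (Fin n)), (∀ a, ‖x a‖ < 1) →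
        (Matrix.of fun a b : Fin m =>
          (1 - 2 * inner ℝ (x a) (x b) + ‖x a‖ ^ 2 * ‖x b‖ ^ 2) ^ (-s / 2)).PosSemidef) :
    s = 0 ∨ (n : ℝ) - 2 ≤ s := by
  by_contra hcon
  push Not at hcon
  obtain ⟨hs0, hlt⟩ := hcon
  obtain ⟨m, x, hx, hnot⟩ := ballKernel_not_posSemidef (lt_of_le_of_ne hs (Ne.symm hs0)) hlt
  exact hnot (H m x hx)

end Literature.Probability.LatticeModels

end
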